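import Literature.AnabelianGeometry.SemiGraphs.PSCSeparatingCoveringsCrossVertex
import Literature.AnabelianGeometry.SemiGraphs.PSCTwoComponentAffineOrigin
import Literature.GroupTheory.CombinatorialGroupTheory.PuncturedSurfaceGroupNodeLoopBasis
import HarnessLib

/-!
# [CombGC] Prop. 1.2, proof p. 9: VERTICIAL separating coverings at the genuine two-component affine data (row F-2829, verticial conjunct)

Mochizuki, *A combinatorial version of the Grothendieck conjecture*, Tohoku Math. J. **59** (2007)
[CombGC], PROOF of Proposition 1.2, author's manuscript p. 9: "if `v₁ ≠ v₂` …, then there exists a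
finite étale … covering `G' → G` whose restriction to the anabelioid `G_{v₂}` is trivial …, but whose
restriction to `G_{v₁}` is nontrivial … by gluing together appropriate finite étale coverings of the
anabelioids `G_v`, `G_e`" [cite: MochizukiCombGC2007, Prop 1.2 proof p.9].  Typed LEVEL-WISE as
`PSCDatum.VerticialSeparatingCoverings` (abc-iut-w4-d081, `PSCSeparatingCoverings.lean`, sub-DAG row
P12-L01-V), the verticial conjunct of abc-iut FACT-LIST rows F-2829 `SeparatingCoverings` / F-2830
`SeparatingCoveringsHolds Ω` (universal closures refuted; previously instance-proved only at ONE-VERTEX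
data, where the verticial case is vacuous: `PSCSeparatingCoveringsSmoothProper.lean`,
`PSCSeparatingCoveringsSmoothCurve.lean`).

PROOF-ONLY file (abc-iut-f-166 gen 3): **the first genuine MULTI-VERTEX instance** — the data of
TWO-COMPONENT AFFINE SHAPE of abc-iut-f-164 (`PSCTwoComponentAffineShape.lean` /
`PSCTwoComponentAffineOrigin.exists_twoComponentAffineDatum`: a pointed stable curve `C₀ ∪_ν C₁`, handles
`i < g₀` and cusps `s ≤ j` on `C₀`, the others on `C₁`, `s ≥ 2`, `r ≥ s + 2`; `Π` a profinite pro-`Σ`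
completion `ι : Γ_{g,r} → Π`, `Π_{v₀} = cl ι⟨a_i, b_i (i<g₀), c_j (j ≥ s)⟩`,
`Π_{v₁} = cl ι⟨a_i, b_i (i ≥ g₀), c_j (j<s), ε⟩`, `ε = (c_s⋯c_{r−1})∏_{i<g₀}[a_i,b_i]` the node loop).
Both vertex groups are closures of FREE FACTORS of `Γ_{g,r}`: `Π_{v₀}` for the `c₀`-eliminating free
basis `a_i, b_i, c_1, …, c_{r−1}`, `Π_{v₁}` for the node-loop basis `a_i, b_i, c_1, …, c_{s−1}, ε,
c_{s+1}, …, c_{r−1}` (`PuncturedSurfaceGroupNodeLoopBasis.lean`; `c_0` is recovered from the relation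
`∏_{i≥g₀}[a_i,b_i]·c_0⋯c_{s−1}·ε = 1`), and `c_{s+1} ∈ Π_{v₀}` resp. `c_1 ∈ Π_{v₁}` survive the
projection killing the other factor.  Hence `PSCDatum.verticialSeparatingCoverings_of_freeFactors'`
(same-vertex pairs: the fibred twist, `PSCSeparatingCoveringsSameVertex.lean`; cross-vertex pairs:
projection, `PSCSeparatingCoveringsCrossVertex.lean`) gives

* `verticialSeparatingCoverings_of_twoComponentAffine` — `G.VerticialSeparatingCoverings` with `V' := V`
  at every datum of two-component affine shape (`Π` in `Type`, the universe of f-164's datum);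
* `exists_twoComponentAffine_verticialSeparatingCoverings` — non-vacuity: an inhabited datum with TWO
  vertices and ONE node (`G.graph.i = 2`, `G.graph.n = 1`) satisfying it.

A shape instance is consistency evidence for the typed schema F-2829 (verticial conjunct), not the printed
statement for all pointed stable curves (cell FOUNDATIONS rows 13–14); the edge-like and `Π^unr`
conjuncts at this shape are not treated here.  0 definitions; nothing here takes a side on
[IUTchIII] Cor. 3.12.
-/

noncomputable section

namespace Literature.AnabelianGeometry.SemiGraphs

namespace PSCDatum

open scoped Pointwise
open Literature.GroupTheory.CombinatorialGroupTheory
open Literature.GroupTheory.CombinatorialGroupTheory.PuncturedSurfaceGroup (a b c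
  exists_freeGroupBasis_elim_zero exists_freeGroupBasis_nodeLoop nodeLoop_rel cusp_prod_lt_eq_c_zero_mul)
open Literature.GroupTheory.CombinatorialGroupTheory.FreeFactorFibredTwist (lift_apply_basis)
open SemiGraphOfAnabelioids (IsProSigmaCompletion)

variable {P : Type} [Group P] [TopologicalSpace P] [IsTopologicalGroup P]
variable [CompactSpace P] [TotallyDisconnectedSpace P] {Sigma : Set ℕ} {g r : ℕ}

/-- **Row P12-L01-V (`VerticialSeparatingCoverings`, verticial conjunct of F-2829) at the genuine
two-component affine data** of abc-iut-f-164: for every open normal `V ⊴ Π` and ANY two distinct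
level-`V` vertices `(v₁', Vγ₁Π_{v₁'}) ≠ (v₂', Vγ₂Π_{v₂'})` there is an open `U ≤ V` (`V' := V`), normal in
`V`, with `γ₂Π_{v₂'}γ₂⁻¹ ∩ V ≤ U` and `γ₁Π_{v₁'}γ₁⁻¹ ∩ V ⊄ U` — over the same vertex by the fibred twist,
over the two different vertices by the projection killing a free factor.
[cite: MochizukiCombGC2007, Prop 1.2 proof p.9] -/
theorem verticialSeparatingCoverings_of_twoComponentAffine (hne : Sigma.Nonempty)
    (hprime : ∀ p ∈ Sigma, p.Prime) (ι : PuncturedSurfaceGroup g r →* P)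
    (hι : IsProSigmaCompletion Sigma ι) (G : PSCDatum P) {g₀ s : ℕ} (hs : 2 ≤ s) (hsr : s + 2 ≤ r)
    (v₀ v₁ : G.graph.V) (hV : ∀ w, w = v₀ ∨ w = v₁) (ε : PuncturedSurfaceGroup g r)
    (hε : ε = ((List.finRange r).map fun j : Fin r =>
          if s ≤ (j : ℕ) then PuncturedSurfaceGroup.c (g := g) j else 1).prod *
        ((List.finRange g).map fun i : Fin g => if (i : ℕ) < g₀ then
          PuncturedSurfaceGroup.a (r := r) i * PuncturedSurfaceGroup.b i *
            (PuncturedSurfaceGroup.a i)⁻¹ * (PuncturedSurfaceGroup.b i)⁻¹ else 1).prod)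
    (hV₀ : G.vertGp v₀ = ((Subgroup.closure {x : PuncturedSurfaceGroup g r |
        (∃ i : Fin g, (i : ℕ) < g₀ ∧ (x = PuncturedSurfaceGroup.a i ∨ x = PuncturedSurfaceGroup.b i)) ∨
        ∃ j : Fin r, s ≤ (j : ℕ) ∧ x = PuncturedSurfaceGroup.c j}).map ι).topologicalClosure)
    (hV₁ : G.vertGp v₁ = ((Subgroup.closure {x : PuncturedSurfaceGroup g r |
        (∃ i : Fin g, g₀ ≤ (i : ℕ) ∧ (x = PuncturedSurfaceGroup.a i ∨ x = PuncturedSurfaceGroup.b i)) ∨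
        (∃ j : Fin r, (j : ℕ) < s ∧ x = PuncturedSurfaceGroup.c j) ∨ x = ε}).map ι).topologicalClosure) :
    G.VerticialSeparatingCoverings := by
  classical
  obtain ⟨r', rfl⟩ : ∃ r', r = r' + 1 := ⟨r - 1, by omega⟩
  have hSig : ∃ ℓ ∈ Sigma, ℓ.Prime := by
    obtain ⟨ℓ, hℓ⟩ := hne
    exact ⟨ℓ, hℓ, hprime ℓ hℓ⟩
  -- the two free bases
  obtain ⟨b₀, ha₀, hb₀, hc₀⟩ := exists_freeGroupBasis_elim_zero g r'
  obtain ⟨b₁, ha₁, hb₁, hc₁, hk₁⟩ :=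
    exists_freeGroupBasis_nodeLoop g r' g₀ s (by omega) (by omega) ε hε
  -- the index sets of the two factors
  let T₀ : Set ((Fin g × Bool) ⊕ Fin r') :=
    {x | Sum.elim (fun p : Fin g × Bool => (p.1 : ℕ) < g₀) (fun j : Fin r' => s ≤ (j : ℕ) + 1) x}
  let T₁ : Set ((Fin g × Bool) ⊕ Fin r') :=
    {x | Sum.elim (fun p : Fin g × Bool => g₀ ≤ (p.1 : ℕ)) (fun j : Fin r' => (j : ℕ) + 1 ≤ s) x}
  have hT₀l : ∀ p : Fin g × Bool, (Sum.inl p : (Fin g × Bool) ⊕ Fin r') ∈ T₀ ↔ (p.1 : ℕ) < g₀ :=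
    fun _ => Iff.rfl
  have hT₀r : ∀ j : Fin r', (Sum.inr j : (Fin g × Bool) ⊕ Fin r') ∈ T₀ ↔ s ≤ (j : ℕ) + 1 := fun _ => Iff.rfl
  have hT₁l : ∀ p : Fin g × Bool, (Sum.inl p : (Fin g × Bool) ⊕ Fin r') ∈ T₁ ↔ g₀ ≤ (p.1 : ℕ) :=
    fun _ => Iff.rfl
  have hT₁r : ∀ j : Fin r', (Sum.inr j : (Fin g × Bool) ⊕ Fin r') ∈ T₁ ↔ (j : ℕ) + 1 ≤ s := fun _ => Iff.rfl
  -- cusps `c_j`, `j ≥ 1`, as members of the two bases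
  have hcusp₀ : ∀ (j : Fin (r' + 1)) (hj : (j : ℕ) ≠ 0),
      b₀ (Sum.inr (j.pred (fun h => hj (by rw [h]; rfl)))) = c j := fun j hj => by
    rw [hc₀, Fin.succ_pred]
  have hcusp₁ : ∀ (j : Fin (r' + 1)) (hj : (j : ℕ) ≠ 0), (j : ℕ) ≠ s →
      b₁ (Sum.inr (j.pred (fun h => hj (by rw [h]; rfl)))) = c j := fun j hj hjs => by
    rw [hc₁ _ (by rw [Fin.val_pred]; omega), Fin.succ_pred]
  -- (1) `Π_{v₀}` is the closure of the free factor `T₀` of `b₀`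
  have hset₀ : {x : PuncturedSurfaceGroup g (r' + 1) |
      (∃ i : Fin g, (i : ℕ) < g₀ ∧ (x = a i ∨ x = b i)) ∨ ∃ j : Fin (r' + 1), s ≤ (j : ℕ) ∧ x = c j} =
      b₀ '' T₀ := by
    ext x
    constructor
    · rintro (⟨i, hi, rfl | rfl⟩ | ⟨j, hj, rfl⟩)
      · exact ⟨Sum.inl (i, false), (hT₀l _).mpr hi, ha₀ i⟩
      · exact ⟨Sum.inl (i, true), (hT₀l _).mpr hi, hb₀ i⟩
      · have hj0 : (j : ℕ) ≠ 0 := by omega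
        refine ⟨Sum.inr (j.pred (fun h => hj0 (by rw [h]; rfl))), (hT₀r _).mpr ?_, hcusp₀ j hj0⟩
        rw [Fin.val_pred]; omega
    · rintro ⟨y, hy, rfl⟩
      rcases y with ⟨i, _ | _⟩ | j
      · exact Or.inl ⟨i, (hT₀l _).mp hy, Or.inl (ha₀ i)⟩
      · exact Or.inl ⟨i, (hT₀l _).mp hy, Or.inr (hb₀ i)⟩
      · exact Or.inr ⟨Fin.succ j, by rw [Fin.val_succ]; exact (hT₀r _).mp hy, hc₀ j⟩
  have hv₀ : G.vertGp v₀ = ((Subgroup.closure (b₀ '' T₀)).map ι).topologicalClosure := by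
    rw [hV₀, hset₀]
  -- (2) `Π_{v₁}` is the closure of the free factor `T₁` of `b₁`
  have hr0 : 0 < r' + 1 := Nat.succ_pos r'
  have hk₁' : b₁ (Sum.inr ⟨s - 1, by omega⟩) = ε := hk₁
  have hc0 : c (g := g) ⟨0, hr0⟩ ∈ Subgroup.closure (b₁ '' T₁) := by
    -- `c_0 = Y⁻¹ ε⁻¹ (c_1⋯c_{s-1})⁻¹` from the relation of the second component
    have hrel := nodeLoop_rel (g := g) (r := r' + 1) g₀ s ε hε
    rw [cusp_prod_lt_eq_c_zero_mul (g := g) s (by omega) hr0] at hrel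
    set Y := ((List.finRange g).map fun i : Fin g => if g₀ ≤ (i : ℕ) then
        a (r := r' + 1) i * b i * (a i)⁻¹ * (b i)⁻¹ else 1).prod with hY
    set Cp := ((List.finRange (r' + 1)).map fun j : Fin (r' + 1) =>
        if 1 ≤ (j : ℕ) ∧ (j : ℕ) < s then c (g := g) j else 1).prod with hC
    have hc0eq : c (g := g) ⟨0, hr0⟩ = Y⁻¹ * (Cp * ε)⁻¹ := by
      have h1 : Y * (c (g := g) ⟨0, hr0⟩ * (Cp * ε)) = 1 := by
        rw [← hrel]; simp only [mul_assoc]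
      exact eq_mul_inv_of_mul_eq (eq_inv_of_mul_eq_one_right h1)
    have haT : ∀ i : Fin g, g₀ ≤ (i : ℕ) → a (r := r' + 1) i ∈ Subgroup.closure (b₁ '' T₁) := fun i hi =>
      Subgroup.subset_closure ⟨Sum.inl (i, false), (hT₁l _).mpr hi, ha₁ i⟩
    have hbT : ∀ i : Fin g, g₀ ≤ (i : ℕ) → b (r := r' + 1) i ∈ Subgroup.closure (b₁ '' T₁) := fun i hi =>
      Subgroup.subset_closure ⟨Sum.inl (i, true), (hT₁l _).mpr hi, hb₁ i⟩
    have hYmem : Y ∈ Subgroup.closure (b₁ '' T₁) := by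
      rw [hY]
      refine prod_map_finRange_ite_mem _ _ _ _ fun i hi => ?_
      exact Subgroup.mul_mem _ (Subgroup.mul_mem _ (Subgroup.mul_mem _ (haT i hi) (hbT i hi))
        (Subgroup.inv_mem _ (haT i hi))) (Subgroup.inv_mem _ (hbT i hi))
    have hCmem : Cp ∈ Subgroup.closure (b₁ '' T₁) := by
      rw [hC]
      refine prod_map_finRange_ite_mem _ _ _ _ fun j hj => ?_
      have hj0 : (j : ℕ) ≠ 0 := by omega
      rw [← hcusp₁ j hj0 (by omega)]
      refine Subgroup.subset_closure ⟨_, (hT₁r _).mpr ?_, rfl⟩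
      rw [Fin.val_pred]; omega
    have hεmem : ε ∈ Subgroup.closure (b₁ '' T₁) := by
      rw [← hk₁']
      exact Subgroup.subset_closure ⟨_, (hT₁r _).mpr (by simp only; omega), rfl⟩
    rw [hc0eq]
    exact Subgroup.mul_mem _ (Subgroup.inv_mem _ hYmem)
      (Subgroup.inv_mem _ (Subgroup.mul_mem _ hCmem hεmem))
  have hclos₁ : Subgroup.closure {x : PuncturedSurfaceGroup g (r' + 1) |
      (∃ i : Fin g, g₀ ≤ (i : ℕ) ∧ (x = a i ∨ x = b i)) ∨
        (∃ j : Fin (r' + 1), (j : ℕ) < s ∧ x = c j) ∨ x = ε} = Subgroup.closure (b₁ '' T₁) := by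
    apply le_antisymm
    · rw [Subgroup.closure_le]
      rintro x (⟨i, hi, rfl | rfl⟩ | ⟨j, hj, rfl⟩ | rfl)
      · exact Subgroup.subset_closure ⟨Sum.inl (i, false), (hT₁l _).mpr hi, ha₁ i⟩
      · exact Subgroup.subset_closure ⟨Sum.inl (i, true), (hT₁l _).mpr hi, hb₁ i⟩
      · by_cases hj0 : (j : ℕ) = 0
        · have : j = ⟨0, hr0⟩ := Fin.ext hj0
          rw [this]; exact hc0
        · rw [← hcusp₁ j hj0 (by omega)]
          refine Subgroup.subset_closure ⟨_, (hT₁r _).mpr ?_, rfl⟩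
          rw [Fin.val_pred]; omega
      · rw [← hk₁']
        exact Subgroup.subset_closure ⟨_, (hT₁r _).mpr (by simp only; omega), rfl⟩
    · rw [Subgroup.closure_le]
      rintro _ ⟨y, hy, rfl⟩
      apply Subgroup.subset_closure
      rcases y with ⟨i, _ | _⟩ | j
      · exact Or.inl ⟨i, (hT₁l _).mp hy, Or.inl (ha₁ i)⟩
      · exact Or.inl ⟨i, (hT₁l _).mp hy, Or.inr (hb₁ i)⟩
      · have hj : (j : ℕ) + 1 ≤ s := (hT₁r _).mp hy
        by_cases hjs : (j : ℕ) + 1 = s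
        · have : j = ⟨s - 1, by omega⟩ := Fin.ext (by simp only; omega)
          rw [this, hk₁']
          exact Or.inr (Or.inr rfl)
        · rw [hc₁ j hjs]
          exact Or.inr (Or.inl ⟨Fin.succ j, by rw [Fin.val_succ]; omega, rfl⟩)
  have hv₁ : G.vertGp v₁ = ((Subgroup.closure (b₁ '' T₁)).map ι).topologicalClosure := by
    rw [hV₁, hclos₁]
  -- (3) the data for `verticialSeparatingCoverings_of_freeFactors'`
  let bs : G.graph.V → FreeGroupBasis ((Fin g × Bool) ⊕ Fin r') (PuncturedSurfaceGroup g (r' + 1)) :=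
    fun v => if v = v₀ then b₀ else b₁
  let Ss : G.graph.V → Set ((Fin g × Bool) ⊕ Fin r') := fun v => if v = v₀ then T₀ else T₁
  have hbs₀ : bs v₀ = b₀ := if_pos rfl
  have hSs₀ : Ss v₀ = T₀ := if_pos rfl
  have hbs₁ : ∀ {v}, v ≠ v₀ → bs v = b₁ := fun h => if_neg h
  have hSs₁ : ∀ {v}, v ≠ v₀ → Ss v = T₁ := fun h => if_neg h
  have hSs : ∀ v, (Ss v).Nonempty := by
    intro v
    by_cases h : v = v₀
    · subst h
      rw [hSs₀]
      exact ⟨Sum.inr ⟨s, by omega⟩, (hT₀r _).mpr (by simp only; omega)⟩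
    · rw [hSs₁ h]
      exact ⟨Sum.inr ⟨0, by omega⟩, (hT₁r _).mpr (by simp only; omega)⟩
  have hv : ∀ v, G.vertGp v = ((Subgroup.closure (bs v '' Ss v)).map ι).topologicalClosure := by
    intro v
    by_cases h : v = v₀
    · subst h
      rw [hbs₀, hSs₀]
      exact hv₀
    · rcases hV v with h' | h'
      · exact absurd h' h
      · subst h'
        rw [hbs₁ h, hSs₁ h]
        exact hv₁
  let ρs : G.graph.V → (PuncturedSurfaceGroup g (r' + 1) →* PuncturedSurfaceGroup g (r' + 1)) :=
    fun v => (bs v).lift fun x => if x ∈ Ss v then 1 else bs v x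
  have hρs : ∀ v x, ρs v (bs v x) = if x ∈ Ss v then 1 else bs v x := fun v x =>
    lift_apply_basis (bs v) _ x
  -- (4) the surviving elements: `c_{s+1} ∈ Π_{v₀}` for `ρ_{v₁}`, `c_1 ∈ Π_{v₁}` for `ρ_{v₀}`
  have hsep : ∀ w₁ w₂ : G.graph.V, w₁ ≠ w₂ → ∃ x, ι x ∈ G.vertGp w₁ ∧ ρs w₂ x ≠ 1 := by
    intro w₁ w₂ hne12
    by_cases h2 : w₂ = v₀
    · -- kill `v₀`, keep `w₁ = v₁`: the cusp `c_1` of `C₁`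
      subst w₂
      have h1 : w₁ ≠ v₀ := hne12
      refine ⟨bs v₀ (Sum.inr ⟨0, by omega⟩), ?_, ?_⟩
      · rw [hv w₁, hbs₁ h1, hSs₁ h1, hbs₀, hc₀]
        refine Subgroup.le_topologicalClosure _ (Subgroup.mem_map_of_mem ι ?_)
        have e1 : c (g := g) (Fin.succ ⟨0, by omega⟩) = b₁ (Sum.inr ⟨0, by omega⟩) := by
          rw [hc₁ _ (by simp only; omega)]
        rw [e1]
        exact Subgroup.subset_closure ⟨_, (hT₁r _).mpr (by simp only; omega), rfl⟩
      · rw [hρs, if_neg (by rw [hSs₀, hT₀r]; simp only; omega)]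
        exact FreeGroupBasis.apply_ne_one _ _
    · -- kill `v₁ = w₂`, keep `w₁ = v₀`: the cusp `c_{s+1}` of `C₀`
      have h1 : w₁ = v₀ := by
        rcases hV w₁ with h | h
        · exact h
        · rcases hV w₂ with h' | h'
          · exact absurd h' h2
          · exact absurd (h.trans h'.symm) hne12
      subst w₁
      refine ⟨bs w₂ (Sum.inr ⟨s, by omega⟩), ?_, ?_⟩
      · rw [hv₀, hbs₁ h2, hc₁ _ (by simp only; omega)]
        refine Subgroup.le_topologicalClosure _ (Subgroup.mem_map_of_mem ι ?_)
        rw [← hc₀]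
        exact Subgroup.subset_closure ⟨_, (hT₀r _).mpr (by simp only; omega), rfl⟩
      · rw [hρs, if_neg (by rw [hSs₁ h2, hT₁r]; simp only; omega)]
        exact FreeGroupBasis.apply_ne_one _ _
  exact G.verticialSeparatingCoverings_of_freeFactors' hι hSig bs Ss hSs hv ρs hρs hsep

/-- **Non-vacuity: an inhabited genuine two-component affine datum with verticial separating
coverings.**  For every nonempty set of primes `Σ` there is a profinite pro-`Σ` datum with TWO vertices
and ONE node (abc-iut-f-164's `exists_twoComponentAffineDatum`, genera `(1,1)`, four cusps, two on each
component) satisfying `VerticialSeparatingCoverings` — at which the verticial clause is NOT vacuous.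
[cite: MochizukiCombGC2007, Prop 1.2 proof p.9] -/
theorem exists_twoComponentAffine_verticialSeparatingCoverings (Sigma : Set ℕ) (hne : Sigma.Nonempty)
    (hprime : ∀ p ∈ Sigma, p.Prime) :
    ∃ (Q : ProfiniteGrp.{0}) (G : PSCDatum Q), G.Sigma = Sigma ∧ G.graph.i = 2 ∧ G.graph.n = 1 ∧
      G.graph.r = 4 ∧ G.VerticialSeparatingCoverings := by
  obtain ⟨Q, ι, G, e, v₀, v₁, n₀, ε, hι, hSg, hi, hn, hr, -, hV, -, hε, hV₀, hV₁, -⟩ :=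
    exists_twoComponentAffineDatum Sigma hne hprime 2 4 1 2
  exact ⟨Q, G, hSg, hi, hn, hr, G.verticialSeparatingCoverings_of_twoComponentAffine hne hprime ι hι
    (g₀ := 1) (s := 2) le_rfl le_rfl v₀ v₁ hV ε hε hV₀ hV₁⟩

end PSCDatum

end Literature.AnabelianGeometry.SemiGraphs

end
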